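import Mathlib.Order.CountableDenseLinearOrder
import Mathlib.Topology.Order.MonotoneContinuity
import Mathlib.Topology.Metrizable.Basic
import Mathlib.Topology.UnitInterval
import Mathlib.Topology.MetricSpace.Pseudo.Lemmas
import Mathlib.Data.Rat.Encodable
import HarnessLib

/-!
# Paths contain arcs, I: the injective reparametrisation along a gap-exact closed set

Topic `Literature/Topology` (general topology; arcs in Hausdorff spaces).  This is the
order-theoretic half of the classical theorem **"the range of a path between two distinct points
of a Hausdorff space contains an arc between them"** (every path-connected Hausdorff space is
arc-connected; e.g. C. O. Christenson, W. L. Voxman, *Aspects of Topology*, 2nd ed. (1998),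
Thm. 9.B.4, via Hahn–Mazurkiewicz and the arcwise connectedness of Peano continua; S. Willard,
*General Topology* (1970), §31).  We avoid Peano continua altogether and argue directly on the
parameter interval; the second half (a Zorn's-lemma "loop erasure") and the main statements are
in `PathsContainArcs.lean`.

Fix `f : ℝ → X` continuous on `[0, 1]` and a closed set `F ⊆ [0, 1]` containing `0, 1`.  Call `F`
**gap-exact** for `f` if for all `s < t` in `F`:
`f s = f t ↔ (s, t) ∩ F = ∅` (written `∀ u ∈ F, u ≤ s ∨ t ≤ u`).  Then `f|_F` takes each value at
most twice, exactly at the two ends of a gap, so it descends to an injective map of the quotient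
`F/∼` (ends of gaps identified); the point is that `F/∼` is an arc:

* `exists_injOn_of_gapExact` — **if `F` is gap-exact for `f` and `f 0 ≠ f 1`, there is
  `h : ℝ → X`, continuous and injective on `[0, 1]`, with `h 0 = f 0`, `h 1 = f 1`,
  `h([0, 1]) ⊆ f(F)`.**

Proof.  Let `T ⊆ F` be the set of *representative* points (points `t ∈ F` such that no `s < t` in
`F` has `f s = f t`; every point of `F` has a representative with the same value,
`gapExact_rep`).  With the order of `ℝ`, `T` is densely ordered (`gapExact_dense`) with least
element `0` and greatest element the representative of `1`; being a subset of `ℝ` it has a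
countable order-dense subset `D`, and Cantor's theorem (Mathlib's `Order.iso_of_countable_dense`)
gives an order isomorphism `e` of `D ∖ {min, max}` with `ℚ ∩ (0, 1)`.  The "devil's staircase"
`φ u := sup {e d | d ∈ D, d ≤ u}` is monotone with dense range in `[0, 1]`, hence continuous; it
takes equal values at `s, t ∈ F` iff `f s = f t`; and `φ(F) = [0, 1]` (compact and dense).  So
`h (φ u) := f u` (`u ∈ F`) is well defined and injective on `[0, 1]`, and continuous because
`φ : F → [0, 1]` is a closed, hence quotient, map.  Everything is proved; no named fact is
introduced; the target space is an arbitrary topological space here (Hausdorffness is only used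
in the Zorn step of part II).

Mathlib has `Path`, `JoinedIn`, `IsPathConnected`, Cantor's isomorphism theorem and
`Monotone.continuous_of_denseRange`, but no arcs / arc-connectedness and no form of this theorem.

## References

* C. O. Christenson, W. L. Voxman, *Aspects of Topology*, 2nd ed., BCS Associates (1998),
  Ch. 9, Thm. 9.B.4 ("a `T₂` space is arc connected iff it is path connected").
* S. Willard, *General Topology*, Addison–Wesley (1970), §31 (Peano spaces, arcwise
  connectedness).
-/

noncomputable section

open Set Filter
open _root_.Topology

namespace Literature.Topology

variable {X : Type*} {f : ℝ → X} {F : Set ℝ}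

/-- Three points of a gap-exact set never carry the same value with the middle one strictly
between. [folklore] -/
theorem gapExact_three
    (hgap : ∀ ⦃s⦄, s ∈ F → ∀ ⦃t⦄, t ∈ F → s < t → (f s = f t ↔ ∀ u ∈ F, u ≤ s ∨ t ≤ u))
    ⦃s : ℝ⦄ (hs : s ∈ F) ⦃t : ℝ⦄ (ht : t ∈ F) ⦃u : ℝ⦄ (hu : u ∈ F) (hst : s < t) (htu : t < u)
    (hsu : f s = f u) : False := by
  rcases (hgap hs hu (hst.trans htu)).1 hsu t ht with h | h
  · exact absurd h (not_le.2 hst)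
  · exact absurd h (not_le.2 htu)

/-- Every point of a gap-exact set `F` has a *representative*: a point `x ≤ t` of `F` with the same
value which is the least point of `F` with that value. [folklore] -/
theorem gapExact_rep
    (hgap : ∀ ⦃s⦄, s ∈ F → ∀ ⦃t⦄, t ∈ F → s < t → (f s = f t ↔ ∀ u ∈ F, u ≤ s ∨ t ≤ u))
    ⦃t : ℝ⦄ (ht : t ∈ F) :
    ∃ x ∈ {t ∈ F | ∀ s ∈ F, s < t → f s ≠ f t}, x ≤ t ∧ f x = f t := by
  by_cases h : ∃ s ∈ F, s < t ∧ f s = f t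
  · obtain ⟨s, hs, hst, hsf⟩ := h
    refine ⟨s, ⟨hs, fun s' hs' hs's heq => ?_⟩, hst.le, hsf⟩
    exact gapExact_three hgap hs' hs ht hs's hst (heq.trans hsf)
  · push Not at h
    exact ⟨t, ⟨ht, fun s hs hst => h s hs hst⟩, le_rfl, rfl⟩

/-- Key order lemma: if the representative `x` of `u ∈ F` lies below a representative point `d`,
then so does `u`. [folklore] -/
theorem gapExact_lt_of_rep_lt
    (hgap : ∀ ⦃s⦄, s ∈ F → ∀ ⦃t⦄, t ∈ F → s < t → (f s = f t ↔ ∀ u ∈ F, u ≤ s ∨ t ≤ u))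
    ⦃d : ℝ⦄ (hd : d ∈ {t ∈ F | ∀ s ∈ F, s < t → f s ≠ f t}) ⦃u : ℝ⦄ (hu : u ∈ F)
    ⦃x : ℝ⦄ (hx : x ∈ F) (hxu : x ≤ u) (hfxu : f x = f u) (hxd : x < d) : u < d := by
  by_contra hdu
  push Not at hdu
  rcases hdu.eq_or_lt with rfl | hdu'
  · exact hd.2 x hx hxd hfxu
  · exact gapExact_three hgap hx hd.1 hu hxd hdu' hfxu

/-- The representative points of a gap-exact set are densely ordered. [folklore] -/
theorem gapExact_dense
    (hgap : ∀ ⦃s⦄, s ∈ F → ∀ ⦃t⦄, t ∈ F → s < t → (f s = f t ↔ ∀ u ∈ F, u ≤ s ∨ t ≤ u))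
    ⦃x : ℝ⦄ (hx : x ∈ {t ∈ F | ∀ s ∈ F, s < t → f s ≠ f t})
    ⦃y : ℝ⦄ (hy : y ∈ {t ∈ F | ∀ s ∈ F, s < t → f s ≠ f t}) (hxy : x < y) :
    ∃ z ∈ {t ∈ F | ∀ s ∈ F, s < t → f s ≠ f t}, x < z ∧ z < y := by
  by_contra hne
  push Not at hne
  have claimA : ∀ r ∈ F, x < r → r < y → f r = f x := by
    intro r hr hxr hry
    obtain ⟨z, hz, hzr, hzf⟩ := gapExact_rep hgap hr
    have hzx : z ≤ x := by
      by_contra h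
      push Not at h
      exact absurd (hne z hz h) (not_le.2 (hzr.trans_lt hry))
    have hxz : x ≤ z := by
      by_contra h
      push Not at h
      exact absurd (gapExact_lt_of_rep_lt hgap hx hr hz.1 hzr hzf h) (not_lt.2 hxr.le)
    obtain rfl : z = x := le_antisymm hzx hxz
    exact hzf.symm
  have hfxy : f x ≠ f y := fun h => hy.2 x hx.1 hxy h
  obtain ⟨r, hr, hxr, hry⟩ : ∃ r ∈ F, x < r ∧ r < y := by
    by_contra h
    push Not at h
    refine hfxy ((hgap hx.1 hy.1 hxy).2 fun u hu => ?_)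
    rcases le_or_gt u x with h' | h'
    · exact Or.inl h'
    · exact Or.inr (h u hu h')
  have hfr : f r = f x := claimA r hr hxr hry
  have hfry : f r = f y := (hgap hr hy.1 hry).2 fun u hu => by
    rcases le_or_gt u r with h' | h'
    · exact Or.inl h'
    rcases le_or_gt y u with h'' | h''
    · exact Or.inr h''
    exact (gapExact_three hgap hx.1 hr hu hxr h' (claimA u hu (hxr.trans h') h'').symm).elim
  exact hfxy (hfr.symm.trans hfry)

section Reparam

variable [TopologicalSpace X]

/-- **Injective reparametrisation along a gap-exact closed set.**  Let `f` be continuous on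
`[0, 1]` with `f 0 ≠ f 1`, and let `F ⊆ [0, 1]` be a closed set containing `0, 1` which is
*gap-exact* for `f`: two points `s < t` of `F` carry the same value iff no point of `F` lies
strictly between them.  Then there is a map `h`, continuous and injective on `[0, 1]`, with
`h 0 = f 0`, `h 1 = f 1` and `h([0, 1]) ⊆ f(F)`.  (The quotient of `F` identifying the two ends of
each gap is a separable, densely and completely ordered arc; an order isomorphism of a countable
dense subset with `ℚ ∩ (0, 1)` — Cantor — extends to a continuous monotone surjection
`φ : F → [0, 1]` identifying exactly the pairs identified by `f`, and `h ∘ φ = f` defines `h`,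
continuous because `φ` is a quotient map.) [folklore] -/
theorem exists_injOn_of_gapExact {f : ℝ → X} (hf : ContinuousOn f (Icc 0 1)) {F : Set ℝ}
    (hF : IsClosed F) (hFI : F ⊆ Icc 0 1) (h0 : (0 : ℝ) ∈ F) (h1 : (1 : ℝ) ∈ F)
    (hgap : ∀ ⦃s⦄, s ∈ F → ∀ ⦃t⦄, t ∈ F → s < t → (f s = f t ↔ ∀ u ∈ F, u ≤ s ∨ t ≤ u))
    (h01 : f 0 ≠ f 1) :
    ∃ h : ℝ → X, ContinuousOn h (Icc 0 1) ∧ InjOn h (Icc 0 1) ∧ h 0 = f 0 ∧ h 1 = f 1 ∧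
      h '' Icc 0 1 ⊆ f '' F := by
  set T : Set ℝ := {t ∈ F | ∀ s ∈ F, s < t → f s ≠ f t} with hT
  have hTF : T ⊆ F := fun t ht => ht.1
  -- endpoints of `T`
  have h0T : (0 : ℝ) ∈ T := ⟨h0, fun s hs hs0 => absurd (hFI hs).1 (not_le.2 hs0)⟩
  obtain ⟨top, htopT, htop1, hftop⟩ := gapExact_rep hgap h1
  have hle_top : ∀ ⦃d⦄, d ∈ T → d ≤ top := fun d hd => by
    by_contra h
    push Not at h
    exact absurd (gapExact_lt_of_rep_lt hgap hd h1 htopT.1 htop1 hftop h) (not_lt.2 (hFI hd.1).2)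
  have htop0 : 0 < top := by
    rcases (hFI htopT.1).1.eq_or_lt with h | h
    · exact absurd (by rw [h]; exact hftop) h01
    · exact h
  -- a countable order-dense subset of `T`
  obtain ⟨D, hDT, hDc, hTD⟩ :=
    (TopologicalSpace.IsSeparable.of_separableSpace T).exists_countable_dense_subset
  have hD : ∀ ⦃x⦄, x ∈ T → ∀ ⦃y⦄, y ∈ T → x < y → ∃ d ∈ D, x < d ∧ d < y := by
    intro x hx y hy hxy
    obtain ⟨z, hz, hxz, hzy⟩ := gapExact_dense hgap hx hy hxy
    obtain ⟨d, hdI, hdD⟩ := mem_closure_iff_nhds.1 (hTD hz) (Ioo x y) (Ioo_mem_nhds hxz hzy)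
    exact ⟨d, hdD, hdI.1, hdI.2⟩
  set D' : Set ℝ := {d ∈ D | 0 < d ∧ d < top} with hD'
  have hD'T : D' ⊆ T := fun d hd => hDT hd.1
  haveI : Countable D' := (hDc.mono fun d hd => hd.1).to_subtype
  haveI : Nonempty D' := by
    obtain ⟨d, hd, h0d, hdt⟩ := hD h0T htopT htop0
    exact ⟨⟨d, hd, h0d, hdt⟩⟩
  haveI : DenselyOrdered D' := ⟨fun a b hab => by
    obtain ⟨d, hd, had, hdb⟩ := hD (hD'T a.2) (hD'T b.2) (Subtype.coe_lt_coe.2 hab)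
    exact ⟨⟨d, hd, a.2.2.1.trans had, hdb.trans b.2.2.2⟩, Subtype.coe_lt_coe.1 had,
      Subtype.coe_lt_coe.1 hdb⟩⟩
  haveI : NoMinOrder D' := ⟨fun a => by
    obtain ⟨d, hd, h0d, hda⟩ := hD h0T (hD'T a.2) a.2.2.1
    exact ⟨⟨d, hd, h0d, hda.trans a.2.2.2⟩, Subtype.coe_lt_coe.1 hda⟩⟩
  haveI : NoMaxOrder D' := ⟨fun a => by
    obtain ⟨d, hd, had, hdt⟩ := hD (hD'T a.2) htopT a.2.2.2
    exact ⟨⟨d, hd, a.2.2.1.trans had, hdt⟩, Subtype.coe_lt_coe.1 had⟩⟩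
  haveI : Nonempty (Ioo (0 : ℚ) 1) := ⟨⟨1 / 2, by norm_num, by norm_num⟩⟩
  obtain ⟨e⟩ := Order.iso_of_countable_dense D' (Ioo (0 : ℚ) 1)
  -- the values `v d = e d ∈ ℚ ∩ (0, 1)` and the staircase `φ u = sup {v d | d ≤ u}`
  set v : D' → ℝ := fun d => ((e d : ℚ) : ℝ) with hv
  have hv_mono : StrictMono v := fun a b hab => by
    have : (e a : ℚ) < (e b : ℚ) := Subtype.coe_lt_coe.2 (e.strictMono hab)
    show ((e a : ℚ) : ℝ) < ((e b : ℚ) : ℝ)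
    exact_mod_cast this
  have hv0 : ∀ d, 0 < v d := fun d => by
    show (0 : ℝ) < ((e d : ℚ) : ℝ)
    exact_mod_cast (e d).2.1
  have hv1 : ∀ d, v d < 1 := fun d => by
    show ((e d : ℚ) : ℝ) < 1
    exact_mod_cast (e d).2.2
  set A : ℝ → Set ℝ := fun u => insert 0 (v '' {d | (d : ℝ) ≤ u}) with hA
  have hA_ne : ∀ u, (A u).Nonempty := fun u => ⟨0, mem_insert _ _⟩
  have hA_le : ∀ u, ∀ a ∈ A u, a ≤ 1 := by
    rintro u a (rfl | ⟨d, -, rfl⟩)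
    · exact zero_le_one
    · exact (hv1 d).le
  have hA_bdd : ∀ u, BddAbove (A u) := fun u => ⟨1, hA_le u⟩
  set φ : ℝ → ℝ := fun u => sSup (A u) with hφ
  have hφ_mono : Monotone φ := fun u u' huu' =>
    csSup_le_csSup (hA_bdd u') (hA_ne u)
      (insert_subset_insert (image_mono fun d (hd : (d : ℝ) ≤ u) => hd.trans huu'))
  have hφ0 : ∀ u, 0 ≤ φ u := fun u => le_csSup (hA_bdd u) (mem_insert _ _)
  have hφ1 : ∀ u, φ u ≤ 1 := fun u => csSup_le (hA_ne u) (hA_le u)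
  have hφv : ∀ d : D', φ d = v d := fun d => by
    refine IsGreatest.csSup_eq ⟨mem_insert_of_mem _ ⟨d, le_refl (d : ℝ), rfl⟩, ?_⟩
    rintro a (rfl | ⟨d', hd', rfl⟩)
    · exact (hv0 d).le
    · exact hv_mono.monotone (Subtype.coe_le_coe.1 hd')
  have hφ_zero : φ 0 = 0 := by
    refine IsGreatest.csSup_eq ⟨mem_insert _ _, ?_⟩
    rintro a (rfl | ⟨d, hd, rfl⟩)
    · exact le_rfl
    · exact absurd hd (not_le.2 d.2.2.1)
  -- `φ` is continuous: monotone with dense range in `[0, 1]`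
  have hφ_cont : Continuous φ := by
    let Ψ : ℝ → Icc (0 : ℝ) 1 := fun u => ⟨φ u, hφ0 u, hφ1 u⟩
    have hΨ : Continuous Ψ := by
      refine Monotone.continuous_of_denseRange (fun u u' h => hφ_mono h) ?_
      refine dense_of_exists_between fun a b hab => ?_
      obtain ⟨q, haq, hqb⟩ := exists_rat_btwn (Subtype.coe_lt_coe.2 hab)
      have hq0 : (0 : ℚ) < q := by exact_mod_cast a.2.1.trans_lt haq
      have hq1 : q < (1 : ℚ) := by exact_mod_cast hqb.trans_le b.2.2
      have hq : (Ψ (e.symm ⟨q, hq0, hq1⟩ : D') : ℝ) = q := by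
        show φ _ = q
        rw [hφv]
        simp [hv]
      refine ⟨Ψ (e.symm ⟨q, hq0, hq1⟩ : D'), mem_range_self _, ?_, ?_⟩
      · exact Subtype.coe_lt_coe.1 (by rw [hq]; exact haq)
      · exact Subtype.coe_lt_coe.1 (by rw [hq]; exact hqb)
    exact continuous_subtype_val.comp hΨ
  -- `φ` identifies exactly the pairs identified by `f`
  have hφ_eq : ∀ ⦃s⦄, s ∈ F → ∀ ⦃t⦄, t ∈ F → s < t → f s = f t → φ s = φ t := by
    intro s hs t ht hst hfst
    have hst' := (hgap hs ht hst).1 hfst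
    have hAst : A s = A t := by
      refine congrArg (insert (0 : ℝ)) (congrArg (image v) (Set.ext fun d => ⟨fun hd => ?_, fun hd => ?_⟩))
      · exact (show (d : ℝ) ≤ s from hd).trans hst.le
      · rcases hst' d (hD'T d.2).1 with h | h
        · exact h
        · have hdT : (d : ℝ) ∈ T := hD'T d.2
          rw [le_antisymm (show (d : ℝ) ≤ t from hd) h] at hdT
          exact absurd hfst (hdT.2 s hs hst)
    show sSup (A s) = sSup (A t)
    rw [hAst]
  have hφ_lt : ∀ ⦃s⦄, s ∈ F → ∀ ⦃t⦄, t ∈ F → s < t → f s ≠ f t → φ s < φ t := by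
    intro s hs t ht hst hfst
    obtain ⟨x, hx, hxs, hfx⟩ := gapExact_rep hgap hs
    obtain ⟨y, hy, hyt, hfy⟩ := gapExact_rep hgap ht
    have hxy : x < y := by
      rcases lt_trichotomy x y with h | h | h
      · exact h
      · refine absurd ?_ hfst
        rw [← hfx, ← hfy, h]
      · exact (gapExact_three hgap hy.1 hx.1 ht h (hxs.trans_lt hst) hfy).elim
    obtain ⟨d, hdD, hxd, hdy⟩ := hD hx hy hxy
    obtain ⟨d', hd'D, hdd', hd'y⟩ := hD (hDT hdD) hy hdy
    have h0x : 0 ≤ x := (hFI hx.1).1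
    have hd : d ∈ D' := ⟨hdD, h0x.trans_lt hxd, hdy.trans_le (hle_top hy)⟩
    have hd' : d' ∈ D' := ⟨hd'D, (h0x.trans_lt hxd).trans hdd', hd'y.trans_le (hle_top hy)⟩
    have hsd : s < d := gapExact_lt_of_rep_lt hgap (hDT hdD) hs hx.1 hxs hfx hxd
    have hd't : d' ≤ t := hd'y.le.trans hyt
    calc φ s ≤ v ⟨d, hd⟩ := by
          refine csSup_le (hA_ne s) ?_
          rintro a (rfl | ⟨d'', hd''s, rfl⟩)
          · exact (hv0 _).le
          · exact (hv_mono (Subtype.coe_lt_coe.1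
              ((show (d'' : ℝ) ≤ s from hd''s).trans_lt hsd))).le
      _ < v ⟨d', hd'⟩ := hv_mono (Subtype.coe_lt_coe.1 hdd')
      _ ≤ φ t := le_csSup (hA_bdd t) (mem_insert_of_mem _ ⟨⟨d', hd'⟩, hd't, rfl⟩)
  have hφ_iff : ∀ ⦃s⦄, s ∈ F → ∀ ⦃t⦄, t ∈ F → (φ s = φ t ↔ f s = f t) := by
    intro s hs t ht
    rcases lt_trichotomy s t with h | rfl | h
    · refine ⟨fun hφst => ?_, hφ_eq hs ht h⟩
      by_contra hne
      exact absurd hφst (hφ_lt hs ht h hne).ne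
    · simp
    · refine ⟨fun hφst => ?_, fun hfst => (hφ_eq ht hs h hfst.symm).symm⟩
      by_contra hne
      exact absurd hφst (hφ_lt ht hs h (Ne.symm hne)).ne'
  -- `φ` maps `F` onto `[0, 1]`
  have hFc : IsCompact F := isCompact_Icc.of_isClosed_subset hF hFI
  have hsurj : Icc (0 : ℝ) 1 ⊆ φ '' F := by
    have hcl : IsClosed (φ '' F) := (hFc.image hφ_cont).isClosed
    intro y hy
    rw [← hcl.closure_eq, Metric.mem_closure_iff]
    intro ε hε
    have hlt : max 0 (y - ε) < min 1 (y + ε) :=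
      lt_min (max_lt zero_lt_one (by linarith [hy.2])) (max_lt (by linarith [hy.1]) (by linarith))
    obtain ⟨q, hq, hq'⟩ := exists_rat_btwn hlt
    have hq0 : (0 : ℚ) < q := by exact_mod_cast (le_max_left _ _).trans_lt hq
    have hq1 : q < (1 : ℚ) := by exact_mod_cast hq'.trans_le (min_le_left _ _)
    set d : D' := e.symm ⟨q, hq0, hq1⟩ with hd
    have hφd : φ d = q := by
      rw [hφv]
      simp [hv, hd]
    refine ⟨φ d, ⟨d, (hD'T d.2).1, rfl⟩, ?_⟩
    rw [hφd, Real.dist_eq, abs_sub_lt_iff]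
    constructor
    · linarith [(le_max_right _ _).trans_lt hq]
    · linarith [hq'.trans_le (min_le_right _ _)]
  have hch : ∀ y ∈ Icc (0 : ℝ) 1, ∃ u ∈ F, φ u = y := fun y hy => by
    obtain ⟨u, hu, huy⟩ := hsurj hy
    exact ⟨u, hu, huy⟩
  choose! ψ hψF hψ using hch
  have hI0 : (0 : ℝ) ∈ Icc (0 : ℝ) 1 := ⟨le_rfl, zero_le_one⟩
  have hI1 : (1 : ℝ) ∈ Icc (0 : ℝ) 1 := ⟨zero_le_one, le_rfl⟩
  refine ⟨f ∘ ψ, ?_, ?_, ?_, ?_, ?_⟩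
  · -- continuity: `φ : F → [0, 1]` is a quotient map and `(f ∘ ψ) ∘ φ = f` on `F`
    haveI : CompactSpace F := isCompact_iff_compactSpace.1 hFc
    let Φ : F → Icc (0 : ℝ) 1 := fun u => ⟨φ u, hφ0 u, hφ1 u⟩
    have hΦc : Continuous Φ := (hφ_cont.comp continuous_subtype_val).subtype_mk _
    have hΦs : Function.Surjective Φ := fun y => by
      obtain ⟨u, hu, huy⟩ := hsurj y.2
      exact ⟨⟨u, hu⟩, Subtype.ext huy⟩
    have hquot : IsQuotientMap Φ := hΦc.isClosedMap.isQuotientMap hΦc hΦs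
    rw [continuousOn_iff_continuous_restrict, hquot.continuous_iff]
    have : (Icc (0 : ℝ) 1).restrict (f ∘ ψ) ∘ Φ = f ∘ Subtype.val := by
      funext u
      show f (ψ (φ u)) = f u
      have hm : φ (u : ℝ) ∈ Icc (0 : ℝ) 1 := ⟨hφ0 u, hφ1 u⟩
      exact (hφ_iff (hψF _ hm) u.2).1 (hψ _ hm)
    rw [this]
    exact hf.comp_continuous continuous_subtype_val fun u => hFI u.2
  · intro y hy y' hy' hyy'
    have := (hφ_iff (hψF y hy) (hψF y' hy')).2 hyy'
    rwa [hψ y hy, hψ y' hy'] at this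
  · show f (ψ 0) = f 0
    exact (hφ_iff (hψF 0 hI0) h0).1 ((hψ 0 hI0).trans hφ_zero.symm)
  · show f (ψ 1) = f 1
    have hφ1' : φ 1 = 1 :=
      le_antisymm (hφ1 1) ((hψ 1 hI1).symm.le.trans (hφ_mono (hFI (hψF 1 hI1)).2))
    exact (hφ_iff (hψF 1 hI1) h1).1 ((hψ 1 hI1).trans hφ1'.symm)
  · rintro _ ⟨y, hy, rfl⟩
    exact ⟨ψ y, hψF y hy, rfl⟩

end Reparam

end Literature.Topology
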